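import Summits.Ventures.HodgeRepro.HodgeSets

/-!
# The rank of a CM type (dimension of the Mumford–Tate group)

Blind re-derivation cell `pub-hodge-repro`, seat `typer` (gen 1).  Continues `CMType.lean` /
`HodgeSets.lean`.

[Gordon] §9.1 (p. 24): "we define the rank of the CM-type `(K, S)` by `rank(K, S) := dim MT(A)`."
Remark there: "The rank of a CM-type seems to have originally been defined by Kubota [B.60], who defined it
as `dim_ℚ {∑_{φ ∈ S} φ(x) : x ∈ K}`.  The equality of this with the dimension of the Mumford–Tate group
follows from the methods in [B.91], see also [B.26] [B.27]."
[Gordon] §9.4 (p. 25): "a CM-type `(K, S)` is said to be nondegenerate if `rank(K, S) = dim A + 1`, and is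
called degenerate otherwise, if `rank(K, S) ≤ dim A`."

## The model

In the finite-group model (`G = Gal(K/ℚ)`, `c` = complex conjugation, `Φ` a CM type) the Mumford–Tate group
of `A` is the subtorus of `T = Res_{K/ℚ} 𝔾_m` generated by the `Aut(ℂ/ℚ)`-conjugates of the Hodge
cocharacter `μ_Φ` (the cocharacter acting by `z` on `e_σ`, `σ ∈ Φ`, and by `1` on `e_σ`, `σ ∈ c • Φ`); the
conjugates are the `μ_{gΦ}`, `g ∈ G`.  Writing cocharacters of `T` as vectors in `ℚ^G` (`μ_{gΦ} ↦ ind (gΦ)`),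
`dim MT(A)` is the rank of the `ℚ`-span of the indicator vectors of the translates `gΦ`, i.e. the rank of the
`G × G` matrix `typeMatrix Φ := (g, h) ↦ [h ∈ gΦ]`.  We TAKE THIS as the definition of the rank here
(`HodgeRepro.cmRank`); it agrees with Kubota's formula [Gordon] §9.4.1 for abelian `G` (character
decomposition of `ℚ[G]`), which is recorded as a separate statement when needed.

## Tools

* `cmRank_le_card_of_rows_mem_span` — an upper bound from an explicit spanning family;
* `le_cmRank_of_det_ne_zero` — a lower bound from an explicit non-vanishing minor;
* `cmRank_le_half_add_one` — `rank ≤ dim A + 1` (the general bound, since `ind (gΦ) + ind (cgΦ) = 1`);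
* `IsNondegenerate` — `rank = dim A + 1` ([Gordon] §9.4).
-/

open Finset Matrix Module
open scoped Pointwise

namespace HodgeRepro

/-! ### Generic rank bounds for rational matrices -/

section MatrixTools

variable {m n ι : Type*} [Fintype m] [Fintype n] [Fintype ι]

/-- An upper bound for the rank: if every row of `A` lies in the span of a family `v : ι → (n → ℚ)`, then
`rank A ≤ |ι|`. -/
theorem rank_le_card_of_rows_mem_span (A : Matrix m n ℚ) (v : ι → n → ℚ)
    (h : ∀ i, A i ∈ Submodule.span ℚ (Set.range v)) : A.rank ≤ Fintype.card ι := by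
  rw [Matrix.rank_eq_finrank_span_row]
  calc finrank ℚ (Submodule.span ℚ (Set.range A.row)) ≤ finrank ℚ (Submodule.span ℚ (Set.range v)) :=
        Submodule.finrank_mono (Submodule.span_le.2 (Set.range_subset_iff.2 h))
    _ ≤ Fintype.card ι := finrank_range_le_card v

omit [Fintype m] in
/-- A lower bound for the rank: an `r × r` minor with non-zero determinant gives `r ≤ rank A`. -/
theorem le_rank_of_det_ne_zero {r : ℕ} (A : Matrix m n ℚ) (rows : Fin r → m) (cols : Fin r → n)
    (h : (A.submatrix rows cols).det ≠ 0) : r ≤ A.rank := by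
  have h1 : (A.submatrix rows cols).rank = r := by
    rw [Matrix.rank_of_isUnit _ ((Matrix.isUnit_iff_isUnit_det _).2 (isUnit_iff_ne_zero.2 h)),
      Fintype.card_fin]
  rw [← h1]
  exact Matrix.rank_submatrix_le A rows cols

omit [Fintype m] in
/-- A matrix whose rows are exactly `r` given vectors has rank `≤ r` when the `r` rows span; combined
with `le_rank_of_det_ne_zero` this pins the rank. -/
theorem rank_eq_of_bounds {r : ℕ} (A : Matrix m n ℚ) (hle : A.rank ≤ r) (hge : r ≤ A.rank) :
    A.rank = r :=
  le_antisymm hle hge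

end MatrixTools

/-! ### The type matrix and the rank of a CM type -/

variable {G : Type*} [Group G] [Fintype G] [DecidableEq G]

/-- The *type matrix* of a subset `Φ ⊆ G`: row `g` is the indicator vector of the Galois translate `gΦ`
(the cocharacter `μ_{gΦ}` written in the basis of `X_*(T) = ℤ^G`). -/
def typeMatrix (Φ : Finset G) : Matrix G G ℚ := fun g h => ind (g • Φ) h

omit [Fintype G] in
/-- Entry `(g, h)` of the type matrix: `1` iff `h ∈ gΦ`. -/
@[simp] theorem typeMatrix_apply (Φ : Finset G) (g h : G) :
    typeMatrix Φ g h = if h ∈ g • Φ then 1 else 0 := rfl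

omit [Fintype G] in
/-- Row `g` of the type matrix is the indicator of `gΦ`. -/
theorem typeMatrix_row (Φ : Finset G) (g : G) : typeMatrix Φ g = ind (g • Φ) := rfl

/-- The *rank* of a CM type: `dim MT(A)` ([Gordon] §9.1), realised as the rank of the type matrix (the
rank of the lattice spanned by the conjugates `μ_{gΦ}` of the Hodge cocharacter). -/
noncomputable def cmRank (Φ : Finset G) : ℕ := (typeMatrix Φ).rank

/-- The rank is the dimension of the span of the indicators of the translates `gΦ`. -/
theorem cmRank_eq_finrank_span (Φ : Finset G) :
    cmRank Φ = finrank ℚ (Submodule.span ℚ (Set.range fun g : G => ind (g • Φ))) := by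
  unfold cmRank
  rw [Matrix.rank_eq_finrank_span_row]
  rfl

/-- `ind (gΦ) + ind (c g Φ) = 1` for a CM type: the two conjugate cocharacters add up to the weight
cocharacter. -/
theorem ind_smul_add_ind_conj_smul {c : G} {Φ : Finset G} (hc : IsComplexConj c) (hΦ : IsCMType c Φ)
    (g h : G) : ind (g • Φ) h + ind (c • g • Φ) h = 1 := by
  rw [ind_conj_type hc (hΦ.smul hc g)]
  ring

/-- The weight vector (all ones) lies in the span of the translates of a CM type. -/
theorem one_mem_span_ind_smul {c : G} {Φ : Finset G} (hc : IsComplexConj c) (hΦ : IsCMType c Φ) :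
    (fun _ : G => (1 : ℚ)) ∈ Submodule.span ℚ (Set.range fun g : G => ind (g • Φ)) := by
  have h : (fun _ : G => (1 : ℚ)) = ind ((1 : G) • Φ) + ind (c • (1 : G) • Φ) := by
    funext h
    simp only [Pi.add_apply]
    rw [ind_smul_add_ind_conj_smul hc hΦ]
  rw [h]
  exact add_mem (Submodule.subset_span ⟨1, rfl⟩) (Submodule.subset_span ⟨c, by rw [one_smul]⟩)

/-- Upper bound `rank ≤ dim A + 1` ([Gordon] §9.4: nondegenerate means equality): the rows `ind (gΦ)`,
`g ∈ G`, lie in the span of the all-ones vector and the rows indexed by a set `R` of representatives of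
the cosets of `{1, c}` (because `ind (cgΦ) = 1 − ind (gΦ)`). -/
theorem cmRank_le_card_add_one_of_reps {c : G} {Φ : Finset G} (hc : IsComplexConj c) (hΦ : IsCMType c Φ)
    (R : Finset G) (hR : ∀ g : G, g ∈ R ∨ c * g ∈ R) :
    cmRank Φ ≤ R.card + 1 := by
  unfold cmRank
  -- the spanning family: the all-ones vector, then the rows indexed by `R`
  let v : Option R → G → ℚ := fun o => o.elim (fun _ => 1) (fun r => ind ((r : G) • Φ))
  have hv : ∀ g : G, typeMatrix Φ g ∈ Submodule.span ℚ (Set.range v) := by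
    intro g
    rcases hR g with hg | hg
    · exact Submodule.subset_span ⟨some ⟨g, hg⟩, rfl⟩
    · -- `ind (gΦ) = 1 − ind (c g Φ)`
      have h1 : typeMatrix Φ g = (fun _ => (1 : ℚ)) - ind ((c * g) • Φ) := by
        funext h
        simp only [typeMatrix_row, Pi.sub_apply]
        have := ind_smul_add_ind_conj_smul hc hΦ g h
        rw [smul_smul] at this
        linarith
      rw [h1]
      exact sub_mem (Submodule.subset_span ⟨none, rfl⟩) (Submodule.subset_span ⟨some ⟨c * g, hg⟩, rfl⟩)
  calc (typeMatrix Φ).rank ≤ Fintype.card (Option R) := rank_le_card_of_rows_mem_span _ v hv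
    _ = R.card + 1 := by rw [Fintype.card_option, Fintype.card_coe]

/-- `rank ≤ |G|/2 + 1 = dim A + 1`: the general bound of [Gordon] §9.4, using `Φ` itself as the set of
coset representatives. -/
theorem cmRank_le_half_add_one {c : G} {Φ : Finset G} (hc : IsComplexConj c) (hΦ : IsCMType c Φ) :
    cmRank Φ ≤ Φ.card + 1 :=
  cmRank_le_card_add_one_of_reps hc hΦ Φ hΦ.mem_or_conj_mem

/-- `rank ≥ 2` for a CM type of a nontrivial CM field: `ind Φ` and `ind (cΦ)` are linearly independent
(disjoint non-empty supports). -/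
theorem two_le_cmRank {c : G} {Φ : Finset G} (hc : IsComplexConj c) (hΦ : IsCMType c Φ) :
    2 ≤ cmRank Φ := by
  unfold cmRank
  -- pick `a ∈ Φ`; then the minor on rows `1, c` and columns `a, c * a` is `!![1, 0; 0, 1]`
  obtain ⟨a, ha⟩ : Φ.Nonempty := Finset.nonempty_iff_ne_empty.2 hΦ.ne_empty
  have hca : c * a ∉ Φ := (hΦ a).1 ha
  refine le_rank_of_det_ne_zero _ ![1, c] ![a, c * a] ?_
  rw [Matrix.det_fin_two]
  simp only [Matrix.submatrix_apply, typeMatrix_apply, Matrix.cons_val_zero, Matrix.cons_val_one,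
    one_smul, hc.mem_smul_iff, hc.mul_mul_cancel]
  simp [ha, hca]

/-- A CM type is *nondegenerate* iff `rank = dim A + 1` ([Gordon] §9.4, with `dim A = |Φ|`). -/
def IsNondegenerate (Φ : Finset G) : Prop := cmRank Φ = Φ.card + 1

/-- The rank of a Galois translate of `Φ` is the rank of `Φ` (the rows are permuted). -/
theorem cmRank_smul (Φ : Finset G) (a : G) : cmRank (a • Φ) = cmRank Φ := by
  unfold cmRank
  have h : typeMatrix (a • Φ) = (typeMatrix Φ).submatrix (Equiv.mulRight a) (Equiv.refl G) := by
    ext g h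
    simp only [typeMatrix_apply, Matrix.submatrix_apply, Equiv.coe_mulRight, Equiv.refl_apply, smul_smul]
  rw [h, Matrix.rank_submatrix]

/-- The rank of the conjugate type `cΦ` is the rank of `Φ`. -/
theorem cmRank_conj (c : G) (Φ : Finset G) : cmRank (c • Φ) = cmRank Φ :=
  cmRank_smul Φ c

end HodgeRepro
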